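import Summits.BirchSwinnertonDyer.Rank1Residual.X1.TamagawaSqueeze
import Summits.BirchSwinnertonDyer.Rank1Residual.X2.IsogenyLambdaInvariant
import Summits.BirchSwinnertonDyer.BirchSwinnertonDyer.Theorems.ByReductionTypeAtTwoOrdIsogenyDualMaps
import Literature.NumberTheory.EllipticCurves.Greenberg1999.MordellWeilRankLayerBoundProofs
import Literature.NumberTheory.EllipticCurves.IwasawaSelmerDualProofs
import Literature.NumberTheory.EllipticCurves.IwasawaSelmerModuleFiniteProofs
import HarnessLib

/-!
# The typed algebraic λ-lower bound `AlgebraicLambdaGE W p k` ("`λ(X(E/ℚ_∞)) ≥ k`") is an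
# ISOGENY-CLASS INVARIANT — unconditionally (route `EisensteinPrimes`, cruxes 3 / 5, line `mudescent`,
# stub `stub_lambdaCount_offLocus`, ALGEBRAIC conjunct; seat bsd-eis-lam-b g0, PART 1b seat (5))

HONEST FRAMING (cell `bsd-eis`, programme §HONESTY: no tranche here proves BSD; this file moves
nothing between columns): THEOREMS ONLY — no definition, no named fact, nothing asserted about any
particular curve, closes nothing. It is a HELPER for the item OWNER's assembly
(`MazurMCOnCellB_of` / `MazurMCOnX1RankZero_of`, skeletons bcae135b… / d113fc0a…, ky g7): the line
`mudescent` DESCENDS every pair `(W, p)` to the étale end `W₀` of its isogeny class (LANDED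
`stub_locate`, p443510 / p443911) and needs the λ-data THERE; the per-pair λ-certificates of the cell
(Greenberg Cor. 5.6 Tamagawa witnesses, rank growth `LayerRankGEAt`, generator counts) are read at
whichever member is convenient. This file says the reading may be moved to `W₀` for free.

WHAT.
* `algebraicLambdaGE_of_isIsogenous` — for `ℚ`-isogenous globally minimal elliptic `W ∼ W'` and any
  prime `p`: `AlgebraicLambdaGE W' p k → AlgebraicLambdaGE W p k`. UNCONDITIONAL: the tree's KERNEL
  theorems `X2.IsogenyLambdaInvariant.lambdaInvariant_eq_of_isIsogenous` (Greenberg–Vatsal p. 28: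
  "the λ-invariant is always unchanged by an isogeny" — the Selmer maps of `φ`, `φ̂` dualise to a
  quasi-inverse pair) and `Theorems.IsogenyMuShift.isTorsion_of_isIsogenous` (cotorsion transports
  along the same pair), plus the discharged existence / finite generation of the dual datum
  (`nonempty_selmerDualData_holds`, `SelmerDualData.module_finite_holds`). No Kato, no `μ`.
* `algebraicLambdaGE_iff_of_isIsogenous` — hence `AlgebraicLambdaGE · p k` is constant on a
  `ℚ`-isogeny class.
* `algebraicLambdaGE_mordellWeilRank_layer` — the binder-free, REDUCTION-FREE form of
  `Iwasawa.RankGrowthLayer.algebraicLambdaGE_of_layerRankGEAt` (Greenberg Thm. 1.9 is PROVED in the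
  tree with no reduction hypothesis, `mordellWeilRank_layer_le_lambdaInvariant`): for every `n`,
  `AlgebraicLambdaGE W p (rank E(ℚ_n))` where `ℚ_n` is the `n`-th layer of any (hence the) cyclotomic
  `ℤ_p`-extension named by the bound's own binder; and `algebraicLambdaGE_of_layerRankGEAt` without
  the `IsOrdinaryAt ∨ multiplicative` hypothesis.
* `algebraicLambdaGE_of_isIsogenous_of_layerRankGEAt` — the two combined: a rank-growth certificate
  at ANY member of the class is a λ-lower bound at the étale end.

NOT HERE (MEMO lam-b-MEMO-1, HOME/): the class-wide mechanism «λ_alg ≥ λ_φ + λ_ψ + Σδ» of the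
ACCEL-LIST at type A — its Ψ-side has no finite value at the étale end (Greenberg LNM 1716 Lemma 5.9:
the quotient character is ramified-ODD) and its GV-shape transcription over-counts at `(11a3, 5)`.

References: [GreenbergVatsal2000] §2 p. 28; [GreenbergLNM1716] §1 Thm. 1.9 (p. 63), §5 Cor. 5.6
(p. 136); ky MEMO-4-K5 §3; HOME/ky-g7/Lines-mudescent.md.
-/

set_option autoImplicit false
-- `Summit.BirchSwinnertonDyer.BirchSwinnertonDyer.…`: the summit and its single sub-problem share a name (D-0017 layout).
set_option linter.dupNamespace false

noncomputable section

open scoped Classical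

open WeierstrassCurve Literature.NumberTheory.EllipticCurves
  Summit.BirchSwinnertonDyer.Rank1Residual
  Summit.BirchSwinnertonDyer.Rank1Residual.X1.TamagawaSqueeze
  Summit.BirchSwinnertonDyer.Rank1Residual.X2.IsogenyLambdaInvariant
  Summit.BirchSwinnertonDyer.BirchSwinnertonDyer.Theorems.IsogenyMuShift

namespace Summit.BirchSwinnertonDyer.BirchSwinnertonDyer.Theorems.EisensteinPrimesAlgebraicLambdaGEIsogeny

variable {W W' : WeierstrassCurve ℚ} [W.IsElliptic] [W.IsGloballyMinimal] [W'.IsElliptic]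
  [W'.IsGloballyMinimal] {p : ℕ} [Fact p.Prime]

/-! ## §1. `AlgebraicLambdaGE` is an isogeny-class invariant -/

/-- **The typed λ-lower bound transports along a `ℚ`-isogeny, unconditionally.** If `W ∼ W'` are
`ℚ`-isogenous globally minimal elliptic curves and `λ(X(E'/ℚ_∞)) ≥ k` for every cyclotomic torsion
dual datum of `E'` (`AlgebraicLambdaGE W' p k`), then the same holds for `E`: given a torsion datum `D`
of `E`, pick any datum `D'` of `E'` over the same `(κ, γ)` (`nonempty_selmerDualData_holds`; finitely
generated by `module_finite_holds`); `D'` is torsion (`isTorsion_of_isIsogenous`) and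
`λ(D.X) = λ(D'.X)` (`lambdaInvariant_eq_of_isIsogenous`). No reduction hypothesis, no Kato, no `μ`.
[cite: GreenbergVatsal2000, §2 p. 28 ("The λ-invariant is always unchanged by an isogeny")] -/
theorem algebraicLambdaGE_of_isIsogenous (hiso : IsIsogenous W W') {k : ℕ}
    (h : AlgebraicLambdaGE W' p k) : AlgebraicLambdaGE W p k := by
  intro κ γ hκ hγ D _ hX
  obtain ⟨D'⟩ := W'.nonempty_selmerDualData_holds κ γ hγ
  haveI : Module.Finite (IwasawaAlgebra p) D'.X := D'.module_finite_holds hγ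
  have hX' : D'.IsTorsion := isTorsion_of_isIsogenous hiso D D' hX
  rw [lambdaInvariant_eq_of_isIsogenous hiso D D']
  exact h κ γ hκ hγ D' hX'

/-- **`AlgebraicLambdaGE · p k` is constant on a `ℚ`-isogeny class.**
[cite: GreenbergVatsal2000, §2 p. 28 ("The λ-invariant is always unchanged by an isogeny")] -/
theorem algebraicLambdaGE_iff_of_isIsogenous (hiso : IsIsogenous W W') {k : ℕ} :
    AlgebraicLambdaGE W p k ↔ AlgebraicLambdaGE W' p k :=
  ⟨algebraicLambdaGE_of_isIsogenous hiso.symm_of_charZero, algebraicLambdaGE_of_isIsogenous hiso⟩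

/-! ## §2. The Mordell–Weil bound over the layers, reduction-free, and its transport -/

/-- **`λ_alg(E,p) ≥ rank_ℤ E(ℚ_n)` for every layer `ℚ_n` of the cyclotomic `ℤ_p`-extension —
reduction-free, binder-free** (Greenberg Thm. 1.9, PROVED in the tree as
`mordellWeilRank_layer_le_lambdaInvariant` for ANY `ℤ_p`-extension; here read inside the bound's own
cyclotomic binder `κ`). [cite: GreenbergLNM1716, Thm. 1.9 (PDF p. 63)] -/
theorem algebraicLambdaGE_of_layerRankGEAt {n m : ℕ} (hm : Iwasawa.LayerRankGEAt W p n m) :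
    AlgebraicLambdaGE W p m :=
  fun κ _ hκ hγ D _ hX ↦ (hm κ hκ).trans (W.mordellWeilRank_layer_le_lambdaInvariant hγ D hX n)

/-- **Layer `0`: `λ_alg(E,p) ≥ rank_ℤ E(ℚ_0)`** in the certificate currency `LayerRankGEAt W p 0 m`
(`ℚ_0 = κ.layer 0`), reduction-free. [cite: GreenbergLNM1716, Thm. 1.9 (PDF p. 63)] -/
theorem algebraicLambdaGE_of_layerRankGEAt_zero {m : ℕ} (hm : Iwasawa.LayerRankGEAt W p 0 m) :
    AlgebraicLambdaGE W p m :=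
  algebraicLambdaGE_of_layerRankGEAt hm

/-- **A rank-growth certificate at ANY member of the isogeny class is a λ-lower bound at every
member** (in particular at the étale end `W₀` of the line `mudescent`).
[cite: GreenbergLNM1716, Thm. 1.9 (PDF p. 63)] [cite: GreenbergVatsal2000, §2 p. 28] -/
theorem algebraicLambdaGE_of_isIsogenous_of_layerRankGEAt (hiso : IsIsogenous W W') {n m : ℕ}
    (hm : Iwasawa.LayerRankGEAt W' p n m) : AlgebraicLambdaGE W p m :=
  algebraicLambdaGE_of_isIsogenous hiso (algebraicLambdaGE_of_layerRankGEAt hm)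

/-! ## §3. In the shape consumed by the skeletons (`W₀` = the off-locus member of `stub_locate`) -/

/-- **Crux 3 / crux 5 reading: any `λ`-lower bound certified at the DISPLAYED member `W` is a bound
at the located member `W₀`.** This is the form the OWNER's composition uses after
`stub_locate W p hc = ⟨W₀, _, _, hiso, hoff⟩`. [cite: GreenbergVatsal2000, §2 p. 28] -/
theorem algebraicLambdaGE_at_located {W₀ : WeierstrassCurve ℚ} [W₀.IsElliptic] [W₀.IsGloballyMinimal]
    (hiso : IsIsogenous W W₀) {k : ℕ} (h : AlgebraicLambdaGE W p k) : AlgebraicLambdaGE W₀ p k :=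
  algebraicLambdaGE_of_isIsogenous hiso.symm_of_charZero h

end Summit.BirchSwinnertonDyer.BirchSwinnertonDyer.Theorems.EisensteinPrimesAlgebraicLambdaGEIsogeny

end
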